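import Summits.ValiantsHypothesis.ValiantsHypothesis.Theorems.GrenetZeonDualUnipotentThreeHalvesHeavyTopTowerDefs

/-!
# `GrenetZeon.DualUnipotentThreeHalves` (stmt-ValiantsHypothesis-24318), R2 heavy-top instrument — the TOWER HULL `T(p, I, q)`:
# RE-EMBEDDING along a block decomposition: `HULL(T(p, I, q), 𝔫_d) = T(p, I, q + d)` and `HULL(𝔫_c, T(p, I, q)) = T(c + p, I, q)` (COROLLARY II port-map step (c2) R, L)

The inductive step of the classification (crux note `CENSUS-THMC-UNIFORM-eng1g5.md` §8.3 (ii)) meets the space `HULL(T(p, I, q), 𝔫_d)` of block matrices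
`[[B₁₁, B₁₂], [0, B₂₂]]` with `B₁₁ ∈ T(p, I, q)`, `B₁₂` arbitrary and `B₂₂` strictly upper triangular, and must recognise it as the tower `T(p, I, q + d)`.
Along the canonical re-indexing `Fin (p+3+q) ⊕ Fin d ≃ Fin (p+3+(q+d))` (`finSumFinEquiv` followed by the associativity cast) this is literally
true, entry by entry:

* `val_emb_inl`, `val_emb_inr`, `blk_emb_inl`, `blk_emb_inr`, `blk_le_two` — the re-indexing on values and block indices;
* `midBlock_reindex_fromBlocks` — the middle block of the re-indexed block matrix is the middle block of `B₁₁`;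
* ★ `reindex_fromBlocks_mem_towerHull_iff` —
  `reindex e e (fromBlocks B₁₁ B₁₂ B₂₁ B₂₂) ∈ towerHull p (q + d) I ↔ B₁₁ ∈ towerHull p q I ∧ B₂₁ = 0 ∧ IsStrictUpper B₂₂`.

* `val_embL_inl`, `val_embL_inr`, `blk_embL_inl`, `blk_embL_inr`, `midBlock_reindex_fromBlocks_left`, ★ `reindex_fromBlocks_mem_towerHull_iff_left` — the
  mirror statement along `Fin c ⊕ Fin (p+3+q) ≃ Fin (c+p+3+q)` (`finSumFinEquiv.trans (finCongr h)`, any `h : c + (p+3+q) = c+p+3+q`):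
  `reindex e e (fromBlocks N B₁₂ B₂₁ T) ∈ towerHull (c + p) q I ↔ IsStrictUpper N ∧ B₂₁ = 0 ∧ T ∈ towerHull p q I` (`HULL(𝔫_c, T(p, I, q)) = T(c + p, I, q)`, port-map step (c2) L).
Honest framing: index bookkeeping; nothing here proves or refutes `HeavyTopLaw`, 24318, S3b or 8062; `VP ≠ VNP` is NOT proved.  No definitions.
[val-idea-30 MEMO codim-one §4 (ii)–(iii); cell val-heavytop-census, eng-1 g5]
-/

noncomputable section

-- single-conjunct layout: Sub = Summit, duplicated namespace component intended
set_option linter.dupNamespace false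

namespace Summit.ValiantsHypothesis.ValiantsHypothesis.Theorems.GrenetZeon.HeavyTopTowerEmbedding

open Matrix
open Summit.ValiantsHypothesis.ValiantsHypothesis.Theorems.GrenetZeon.HeavyTopTowerDefs
open Literature.LinearAlgebra.Matrix (IsStrictUpper)

/-! ## The re-indexing `Fin (p+3+q) ⊕ Fin d ≃ Fin (p+3+(q+d))` on values and block indices -/

/-- Value of the re-indexing on the left summand. -/
theorem val_emb_inl (p q d : ℕ) (i : Fin (p + 3 + q)) :
    (((finSumFinEquiv.trans (finCongr (Nat.add_assoc (p + 3) q d))) (Sum.inl i) : Fin (p + 3 + (q + d))) : ℕ) = i := by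
  rw [Equiv.trans_apply, finSumFinEquiv_apply_left, finCongr_apply, Fin.val_cast, Fin.val_castAdd]

/-- Value of the re-indexing on the right summand. -/
theorem val_emb_inr (p q d : ℕ) (k : Fin d) :
    (((finSumFinEquiv.trans (finCongr (Nat.add_assoc (p + 3) q d))) (Sum.inr k) : Fin (p + 3 + (q + d))) : ℕ) = p + 3 + q + k := by
  rw [Equiv.trans_apply, finSumFinEquiv_apply_right, finCongr_apply, Fin.val_cast, Fin.val_natAdd]

/-- The block index takes values `≤ 2`. -/
theorem blk_le_two (p i : ℕ) : blk p i ≤ 2 := by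
  unfold blk; split_ifs <;> omega

/-- Block index on the left summand: unchanged. -/
theorem blk_emb_inl (p q d : ℕ) (i : Fin (p + 3 + q)) :
    blk p (((finSumFinEquiv.trans (finCongr (Nat.add_assoc (p + 3) q d))) (Sum.inl i) : Fin (p + 3 + (q + d))) : ℕ) = blk p i := by
  rw [val_emb_inl]

/-- Block index on the right summand: `2`. -/
theorem blk_emb_inr (p q d : ℕ) (k : Fin d) :
    blk p (((finSumFinEquiv.trans (finCongr (Nat.add_assoc (p + 3) q d))) (Sum.inr k) : Fin (p + 3 + (q + d))) : ℕ) = 2 := by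
  rw [val_emb_inr]
  unfold blk
  rw [if_neg (by omega), if_neg (by omega)]

/-! ## The middle block -/

/-- The middle block of the re-indexed block matrix is the middle block of its top-left block. -/
theorem midBlock_reindex_fromBlocks (p q d : ℕ) (B₁₁ : Matrix (Fin (p + 3 + q)) (Fin (p + 3 + q)) ℂ) (B₁₂ : Matrix (Fin (p + 3 + q)) (Fin d) ℂ)
    (B₂₁ : Matrix (Fin d) (Fin (p + 3 + q)) ℂ) (B₂₂ : Matrix (Fin d) (Fin d) ℂ) :
    midBlock p (q + d) (Matrix.reindex (finSumFinEquiv.trans (finCongr (Nat.add_assoc (p + 3) q d)))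
        (finSumFinEquiv.trans (finCongr (Nat.add_assoc (p + 3) q d))) (Matrix.fromBlocks B₁₁ B₁₂ B₂₁ B₂₂)) =
      midBlock p q B₁₁ := by
  ext a b
  have ha : (⟨p + (a : ℕ), by omega⟩ : Fin (p + 3 + (q + d))) =
      (finSumFinEquiv.trans (finCongr (Nat.add_assoc (p + 3) q d))) (Sum.inl ⟨p + (a : ℕ), by omega⟩) :=
    Fin.ext (by rw [val_emb_inl])
  have hb : (⟨p + (b : ℕ), by omega⟩ : Fin (p + 3 + (q + d))) =
      (finSumFinEquiv.trans (finCongr (Nat.add_assoc (p + 3) q d))) (Sum.inl ⟨p + (b : ℕ), by omega⟩) :=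
    Fin.ext (by rw [val_emb_inl])
  rw [midBlock_apply, midBlock_apply, ha, hb, Matrix.reindex_apply, Matrix.submatrix_apply, Equiv.symm_apply_apply, Equiv.symm_apply_apply,
    Matrix.fromBlocks_apply₁₁]

/-! ## ★ The re-embedding lemma R: `HULL(T(p, I, q), 𝔫_d) = T(p, I, q + d)` -/

/-- ★ **Re-embedding (R).**  Along `Fin (p+3+q) ⊕ Fin d ≃ Fin (p+3+(q+d))`, the block matrix `[[B₁₁, B₁₂], [B₂₁, B₂₂]]` lies in the tower `T(p, I, q + d)`
iff `B₁₁ ∈ T(p, I, q)`, `B₂₁ = 0` and `B₂₂` is strictly upper triangular (`B₁₂` is free). [val-idea-30 MEMO codim-one §4 (iii), `HULL(T(p,I,q), 𝔫_d) = T(p, I, q+d)`] -/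
theorem reindex_fromBlocks_mem_towerHull_iff {p q d : ℕ} (I : Submodule ℂ (Matrix (Fin 3) (Fin 3) ℂ))
    (B₁₁ : Matrix (Fin (p + 3 + q)) (Fin (p + 3 + q)) ℂ) (B₁₂ : Matrix (Fin (p + 3 + q)) (Fin d) ℂ)
    (B₂₁ : Matrix (Fin d) (Fin (p + 3 + q)) ℂ) (B₂₂ : Matrix (Fin d) (Fin d) ℂ) :
    Matrix.reindex (finSumFinEquiv.trans (finCongr (Nat.add_assoc (p + 3) q d))) (finSumFinEquiv.trans (finCongr (Nat.add_assoc (p + 3) q d)))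
        (Matrix.fromBlocks B₁₁ B₁₂ B₂₁ B₂₂) ∈ towerHull p (q + d) I ↔
      B₁₁ ∈ towerHull p q I ∧ B₂₁ = 0 ∧ IsStrictUpper B₂₂ := by
  rw [mem_towerHull, mem_towerHull, midBlock_reindex_fromBlocks]
  constructor
  · rintro ⟨⟨h1, h2⟩, h3⟩
    -- evaluate the two shape conditions at re-indexed pairs
    have h1' : ∀ x y : Fin (p + 3 + q) ⊕ Fin d,
        blk p ((finSumFinEquiv.trans (finCongr (Nat.add_assoc (p + 3) q d))) y : ℕ) <
          blk p ((finSumFinEquiv.trans (finCongr (Nat.add_assoc (p + 3) q d))) x : ℕ) →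
        Matrix.fromBlocks B₁₁ B₁₂ B₂₁ B₂₂ x y = 0 := by
      intro x y hxy
      have := h1 _ _ hxy
      rwa [Matrix.reindex_apply, Matrix.submatrix_apply, Equiv.symm_apply_apply, Equiv.symm_apply_apply] at this
    have h2' : ∀ x y : Fin (p + 3 + q) ⊕ Fin d,
        blk p ((finSumFinEquiv.trans (finCongr (Nat.add_assoc (p + 3) q d))) x : ℕ) =
          blk p ((finSumFinEquiv.trans (finCongr (Nat.add_assoc (p + 3) q d))) y : ℕ) →
        blk p ((finSumFinEquiv.trans (finCongr (Nat.add_assoc (p + 3) q d))) x : ℕ) ≠ 1 →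
        (((finSumFinEquiv.trans (finCongr (Nat.add_assoc (p + 3) q d))) y : ℕ) ≤
          ((finSumFinEquiv.trans (finCongr (Nat.add_assoc (p + 3) q d))) x : ℕ)) →
        Matrix.fromBlocks B₁₁ B₁₂ B₂₁ B₂₂ x y = 0 := by
      intro x y hxy h1x hyx
      have := h2 _ _ hxy h1x hyx
      rwa [Matrix.reindex_apply, Matrix.submatrix_apply, Equiv.symm_apply_apply, Equiv.symm_apply_apply] at this
    refine ⟨⟨⟨fun i j hij => ?_, fun i j hij hi1 hji => ?_⟩, h3⟩, ?_, fun k l hlk => ?_⟩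
    · have := h1' (Sum.inl i) (Sum.inl j) (by rwa [blk_emb_inl, blk_emb_inl])
      rwa [Matrix.fromBlocks_apply₁₁] at this
    · have := h2' (Sum.inl i) (Sum.inl j) (by rw [blk_emb_inl, blk_emb_inl, hij]) (by rwa [blk_emb_inl]) (by rwa [val_emb_inl, val_emb_inl])
      rwa [Matrix.fromBlocks_apply₁₁] at this
    · ext k j
      rw [Matrix.zero_apply]
      rcases lt_or_ge (blk p j) 2 with hj | hj
      · have := h1' (Sum.inr k) (Sum.inl j) (by rwa [blk_emb_inl, blk_emb_inr])
        rwa [Matrix.fromBlocks_apply₂₁] at this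
      · have hj2 : blk p j = 2 := le_antisymm (blk_le_two p j) hj
        have := h2' (Sum.inr k) (Sum.inl j) (by rw [blk_emb_inr, blk_emb_inl, hj2]) (by rw [blk_emb_inr]; omega)
          (by rw [val_emb_inl, val_emb_inr]; have := j.isLt; omega)
        rwa [Matrix.fromBlocks_apply₂₁] at this
    · have := h2' (Sum.inr k) (Sum.inr l) (by rw [blk_emb_inr, blk_emb_inr]) (by rw [blk_emb_inr]; omega)
        (by rw [val_emb_inr, val_emb_inr]; have := Fin.le_def.1 hlk; omega)
      rwa [Matrix.fromBlocks_apply₂₂] at this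
  · rintro ⟨⟨⟨g1, g2⟩, g3⟩, h21, h22⟩
    refine ⟨⟨fun x y hxy => ?_, fun x y hxy hx1 hyx => ?_⟩, g3⟩
    · obtain ⟨x, rfl⟩ := (finSumFinEquiv.trans (finCongr (Nat.add_assoc (p + 3) q d))).surjective x
      obtain ⟨y, rfl⟩ := (finSumFinEquiv.trans (finCongr (Nat.add_assoc (p + 3) q d))).surjective y
      rw [Matrix.reindex_apply, Matrix.submatrix_apply, Equiv.symm_apply_apply, Equiv.symm_apply_apply]
      rcases x with i | k <;> rcases y with j | l
      · rw [blk_emb_inl, blk_emb_inl] at hxy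
        rw [Matrix.fromBlocks_apply₁₁]; exact g1 i j hxy
      · rw [blk_emb_inl, blk_emb_inr] at hxy
        exact absurd hxy (not_lt.2 (blk_le_two p i))
      · rw [Matrix.fromBlocks_apply₂₁, h21, Matrix.zero_apply]
      · rw [blk_emb_inr, blk_emb_inr] at hxy
        exact absurd hxy (lt_irrefl _)
    · obtain ⟨x, rfl⟩ := (finSumFinEquiv.trans (finCongr (Nat.add_assoc (p + 3) q d))).surjective x
      obtain ⟨y, rfl⟩ := (finSumFinEquiv.trans (finCongr (Nat.add_assoc (p + 3) q d))).surjective y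
      rw [Matrix.reindex_apply, Matrix.submatrix_apply, Equiv.symm_apply_apply, Equiv.symm_apply_apply]
      rcases x with i | k <;> rcases y with j | l
      · rw [blk_emb_inl, blk_emb_inl] at hxy
        rw [blk_emb_inl] at hx1
        rw [val_emb_inl, val_emb_inl] at hyx
        rw [Matrix.fromBlocks_apply₁₁]; exact g2 i j hxy hx1 hyx
      · rw [val_emb_inl, val_emb_inr] at hyx
        have := i.isLt
        exact absurd hyx (by omega)
      · rw [Matrix.fromBlocks_apply₂₁, h21, Matrix.zero_apply]
      · rw [val_emb_inr, val_emb_inr] at hyx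
        rw [Matrix.fromBlocks_apply₂₂]
        exact h22 k l (Fin.le_def.2 (by omega))

/-! ## ★ The re-embedding lemma L: `HULL(𝔫_c, T(p, I, q)) = T(c + p, I, q)` -/

/-- Value of the left re-indexing `Fin c ⊕ Fin (p+3+q) ≃ Fin (c+p+3+q)` on the left summand. -/
theorem val_embL_inl (c p q : ℕ) (h : c + (p + 3 + q) = c + p + 3 + q) (i : Fin c) :
    (((finSumFinEquiv.trans (finCongr h)) (Sum.inl i) : Fin (c + p + 3 + q)) : ℕ) = i := by
  rw [Equiv.trans_apply, finSumFinEquiv_apply_left, finCongr_apply, Fin.val_cast, Fin.val_castAdd]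

/-- Value of the left re-indexing on the right summand. -/
theorem val_embL_inr (c p q : ℕ) (h : c + (p + 3 + q) = c + p + 3 + q) (k : Fin (p + 3 + q)) :
    (((finSumFinEquiv.trans (finCongr h)) (Sum.inr k) : Fin (c + p + 3 + q)) : ℕ) = c + k := by
  rw [Equiv.trans_apply, finSumFinEquiv_apply_right, finCongr_apply, Fin.val_cast, Fin.val_natAdd]

/-- Block index (for the block sizes `(c + p, 3, q)`) on the left summand: `0`. -/
theorem blk_embL_inl (c p q : ℕ) (h : c + (p + 3 + q) = c + p + 3 + q) (i : Fin c) :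
    blk (c + p) (((finSumFinEquiv.trans (finCongr h)) (Sum.inl i) : Fin (c + p + 3 + q)) : ℕ) = 0 := by
  rw [val_embL_inl]
  have := i.isLt
  unfold blk
  rw [if_pos (by omega)]

/-- Block index on the right summand: shifted, `blk (c + p) (c + k) = blk p k`. -/
theorem blk_embL_inr (c p q : ℕ) (h : c + (p + 3 + q) = c + p + 3 + q) (k : Fin (p + 3 + q)) :
    blk (c + p) (((finSumFinEquiv.trans (finCongr h)) (Sum.inr k) : Fin (c + p + 3 + q)) : ℕ) = blk p k := by
  rw [val_embL_inr]
  unfold blk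
  split_ifs <;> omega

/-- The middle block of the left re-indexed block matrix is the middle block of its bottom-right block. -/
theorem midBlock_reindex_fromBlocks_left (c p q : ℕ) (h : c + (p + 3 + q) = c + p + 3 + q) (N : Matrix (Fin c) (Fin c) ℂ) (B₁₂ : Matrix (Fin c) (Fin (p + 3 + q)) ℂ)
    (B₂₁ : Matrix (Fin (p + 3 + q)) (Fin c) ℂ) (T : Matrix (Fin (p + 3 + q)) (Fin (p + 3 + q)) ℂ) :
    midBlock (c + p) q (Matrix.reindex (finSumFinEquiv.trans (finCongr h))
        (finSumFinEquiv.trans (finCongr h)) (Matrix.fromBlocks N B₁₂ B₂₁ T)) =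
      midBlock p q T := by
  ext a b
  have ha : (⟨c + p + (a : ℕ), by omega⟩ : Fin (c + p + 3 + q)) =
      (finSumFinEquiv.trans (finCongr h)) (Sum.inr ⟨p + (a : ℕ), by omega⟩) :=
    Fin.ext (by rw [val_embL_inr]; dsimp only; omega)
  have hb : (⟨c + p + (b : ℕ), by omega⟩ : Fin (c + p + 3 + q)) =
      (finSumFinEquiv.trans (finCongr h)) (Sum.inr ⟨p + (b : ℕ), by omega⟩) :=
    Fin.ext (by rw [val_embL_inr]; dsimp only; omega)
  rw [midBlock_apply, midBlock_apply, ha, hb, Matrix.reindex_apply, Matrix.submatrix_apply, Equiv.symm_apply_apply, Equiv.symm_apply_apply,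
    Matrix.fromBlocks_apply₂₂]

/-- ★ **Re-embedding (L).**  Along `Fin c ⊕ Fin (p+3+q) ≃ Fin (c+p+3+q)`, the block matrix `[[N, B₁₂], [B₂₁, T]]` lies in the tower `T(c + p, I, q)` iff
`N` is strictly upper triangular, `B₂₁ = 0` and `T ∈ T(p, I, q)` (`B₁₂` is free). [val-idea-30 MEMO codim-one §4 (iii), `HULL(𝔫_c, T(p,I,q)) = T(c+p, I, q)`] -/
theorem reindex_fromBlocks_mem_towerHull_iff_left {c p q : ℕ} (h : c + (p + 3 + q) = c + p + 3 + q) (I : Submodule ℂ (Matrix (Fin 3) (Fin 3) ℂ))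
    (N : Matrix (Fin c) (Fin c) ℂ) (B₁₂ : Matrix (Fin c) (Fin (p + 3 + q)) ℂ)
    (B₂₁ : Matrix (Fin (p + 3 + q)) (Fin c) ℂ) (T : Matrix (Fin (p + 3 + q)) (Fin (p + 3 + q)) ℂ) :
    Matrix.reindex (finSumFinEquiv.trans (finCongr h))
        (finSumFinEquiv.trans (finCongr h)) (Matrix.fromBlocks N B₁₂ B₂₁ T) ∈ towerHull (c + p) q I ↔
      IsStrictUpper N ∧ B₂₁ = 0 ∧ T ∈ towerHull p q I := by
  rw [mem_towerHull, mem_towerHull, midBlock_reindex_fromBlocks_left]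
  constructor
  · rintro ⟨⟨h1, h2⟩, h3⟩
    have h1' : ∀ x y : Fin c ⊕ Fin (p + 3 + q),
        blk (c + p) ((finSumFinEquiv.trans (finCongr h)) y : ℕ) < blk (c + p) ((finSumFinEquiv.trans (finCongr h)) x : ℕ) →
        Matrix.fromBlocks N B₁₂ B₂₁ T x y = 0 := by
      intro x y hxy
      have := h1 _ _ hxy
      rwa [Matrix.reindex_apply, Matrix.submatrix_apply, Equiv.symm_apply_apply, Equiv.symm_apply_apply] at this
    have h2' : ∀ x y : Fin c ⊕ Fin (p + 3 + q),
        blk (c + p) ((finSumFinEquiv.trans (finCongr h)) x : ℕ) = blk (c + p) ((finSumFinEquiv.trans (finCongr h)) y : ℕ) → blk (c + p) ((finSumFinEquiv.trans (finCongr h)) x : ℕ) ≠ 1 →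
        (((finSumFinEquiv.trans (finCongr h)) y : ℕ) ≤ ((finSumFinEquiv.trans (finCongr h)) x : ℕ)) →
        Matrix.fromBlocks N B₁₂ B₂₁ T x y = 0 := by
      intro x y hxy h1x hyx
      have := h2 _ _ hxy h1x hyx
      rwa [Matrix.reindex_apply, Matrix.submatrix_apply, Equiv.symm_apply_apply, Equiv.symm_apply_apply] at this
    refine ⟨fun i j hji => ?_, ?_, ⟨fun k l hkl => ?_, fun k l hkl hk1 hlk => ?_⟩, h3⟩
    · have := h2' (Sum.inl i) (Sum.inl j) (by rw [blk_embL_inl, blk_embL_inl]) (by rw [blk_embL_inl]; omega)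
        (by rw [val_embL_inl, val_embL_inl]; exact Fin.le_def.1 hji)
      rwa [Matrix.fromBlocks_apply₁₁] at this
    · ext k j
      rw [Matrix.zero_apply]
      rcases Nat.eq_zero_or_pos (blk p k) with hk | hk
      · have := h2' (Sum.inr k) (Sum.inl j) (by rw [blk_embL_inr, blk_embL_inl, hk]) (by rw [blk_embL_inr]; omega)
          (by rw [val_embL_inl, val_embL_inr]; have := j.isLt; omega)
        rwa [Matrix.fromBlocks_apply₂₁] at this
      · have := h1' (Sum.inr k) (Sum.inl j) (by rwa [blk_embL_inl, blk_embL_inr])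
        rwa [Matrix.fromBlocks_apply₂₁] at this
    · have := h1' (Sum.inr k) (Sum.inr l) (by rwa [blk_embL_inr, blk_embL_inr])
      rwa [Matrix.fromBlocks_apply₂₂] at this
    · have := h2' (Sum.inr k) (Sum.inr l) (by rw [blk_embL_inr, blk_embL_inr, hkl]) (by rwa [blk_embL_inr])
        (by rw [val_embL_inr, val_embL_inr]; omega)
      rwa [Matrix.fromBlocks_apply₂₂] at this
  · rintro ⟨hN, h21, ⟨g1, g2⟩, g3⟩
    refine ⟨⟨fun x y hxy => ?_, fun x y hxy hx1 hyx => ?_⟩, g3⟩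
    · obtain ⟨x, rfl⟩ := (finSumFinEquiv.trans (finCongr h)).surjective x
      obtain ⟨y, rfl⟩ := (finSumFinEquiv.trans (finCongr h)).surjective y
      rw [Matrix.reindex_apply, Matrix.submatrix_apply, Equiv.symm_apply_apply, Equiv.symm_apply_apply]
      rcases x with i | k <;> rcases y with j | l
      · rw [blk_embL_inl, blk_embL_inl] at hxy
        exact absurd hxy (lt_irrefl _)
      · rw [blk_embL_inl, blk_embL_inr] at hxy
        exact absurd hxy (Nat.not_lt_zero _)
      · rw [Matrix.fromBlocks_apply₂₁, h21, Matrix.zero_apply]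
      · rw [blk_embL_inr, blk_embL_inr] at hxy
        rw [Matrix.fromBlocks_apply₂₂]; exact g1 k l hxy
    · obtain ⟨x, rfl⟩ := (finSumFinEquiv.trans (finCongr h)).surjective x
      obtain ⟨y, rfl⟩ := (finSumFinEquiv.trans (finCongr h)).surjective y
      rw [Matrix.reindex_apply, Matrix.submatrix_apply, Equiv.symm_apply_apply, Equiv.symm_apply_apply]
      rcases x with i | k <;> rcases y with j | l
      · rw [val_embL_inl, val_embL_inl] at hyx
        rw [Matrix.fromBlocks_apply₁₁]; exact hN i j (Fin.le_def.2 hyx)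
      · rw [val_embL_inl, val_embL_inr] at hyx
        have := i.isLt
        exact absurd hyx (by omega)
      · rw [Matrix.fromBlocks_apply₂₁, h21, Matrix.zero_apply]
      · rw [blk_embL_inr, blk_embL_inr] at hxy
        rw [blk_embL_inr] at hx1
        rw [val_embL_inr, val_embL_inr] at hyx
        rw [Matrix.fromBlocks_apply₂₂]
        exact g2 k l hxy hx1 (by omega)


end Summit.ValiantsHypothesis.ValiantsHypothesis.Theorems.GrenetZeon.HeavyTopTowerEmbedding

end
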